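import Literature.Computability.MetaComplexity.ConstructiveSeparations
import Literature.Computability.MetaComplexity.ConstructiveSeparationsParitySearch
import Literature.Computability.Complexity.ParityClosure
import Literature.Computability.Complexity.BPClosureProofs
import Literature.Computability.Complexity.CapBricks
import HarnessLib

/-!
# Refuters for `⊕P`: levels, the self-reducible witness language, local inconsistency

Topic `Literature/Computability/MetaComplexity`; second support file of the proof of
`constructiveSeparation_of_not_subset_BPP_ParityP` (Chen–Jin–Santhanam–Williams 2022, Thm. 1.2,
second sentence, `𝒞 = BPP`; architecture in `ConstructiveSeparationsProofs.lean`). It fixes the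
DATA of the proof (`Ctx`: the hard language `L`, the refuted language `A`, a witness relation
`W ∈ P` with witness length `p₁` of some `⊕P` language `L₁ ∉ BPP`, a Karp reduction `red` to `L`,
the padding `pad` of `L`, a padded length `Λ₁`) and proves the deterministic part of §5.3 of the
paper in the tree's language:

* `Mlang W p₁` — the **self-reducible version** of `L₁`: `⟨x, ρ⟩ ∈ M` iff the number of
  `y' ∈ {0,1}^{p₁(|x|) - |ρ|}` with `⟨x, ρ y'⟩ ∈ W` is odd. It is in `⊕P` (`Mlang_mem_ParityP`, by
  `⊕·⊕P ⊆ ⊕P`), satisfies `M(x, ρ) = M(x, ρ0) ⊕ M(x, ρ1)` below the witness length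
  (`mem_Mlang_step`) and `M(x, ρ) = W(x, ρ)` at it (`mem_Mlang_leaf`), and `x ∈ L₁ ↔ ⟨x, ε⟩ ∈ M`
  (`mem_Mlang_nil_iff`). (The printed proof uses `⊕SAT` and its downward self-reducibility; the
  witness-parity language of ANY `⊕P` language outside `BPP` serves and needs no Cook–Levin.)
* **Levels.** Instances `⟨x, ρ⟩` with `|x| ≤ n`, `|ρ| ≤ p₁(n)` are coded by the words
  `t ∈ {0,1}^{S(n)}`, `S(n) = (n + 1) + (p₁(n) + 1)`, through the `10*`-padding of both components
  (`code`, `inst`, `inst_code`); `Ctx.Rn n v = pad (red v, Λ₁ n)` maps an instance to an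
  `L`-instance of length exactly `Λ₁(n)` with the same `M`-value (`Rn_spec`), and
  `Ctx.tri n t : Fin 3 → {0,1}^{Λ₁ n}` is the triple (instance, left child, right child).
* `Ctx.Cloc n t` — **local inconsistency of `A` at `t`** ("`A(R φ) ≠ A(R φ₀) ⊕ A(R φ₁)`", and at
  the witness length "`A(R φ) ≠ W(φ)`"); `Ctx.GoodLevel n` — some word of level `n` is locally
  inconsistent. **`exists_tri_mem_symmDiff`**: at a locally inconsistent `t` one of the three
  strings of the triple lies in `L ∆ A` (the `L`-values are consistent because `red` reduces `M`).
  **`frequently_goodLevel`**: if `A ∈ BPP` and `L₁ ∉ BPP` then infinitely many levels are good —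
  otherwise, by downward induction on `p₁(|x|) - |ρ|` (`A_agrees_of_quiet`), `A ∘ Rn` computes `M`
  on all late levels and `L₁ = F⁻¹(A) ∈ BPP` for the polynomial-time `F x = Rn (|x| + n₀) ⟨x, ε⟩`
  ("otherwise it would contradict the assumption that `⊕P ⊄ 𝒞`", §5.3).

## References

* L. Chen, C. Jin, R. Santhanam, R. Williams, *Constructive separations and their consequences*,
  arXiv:2203.14379v5 (FOCS 2021; TheoretiCS 2024), Thm. 1.2 and §5.3 (Theorems "Refuters for PP"
  and "… `⊕P`") [ChenEtAl2022].
* S. Arora, B. Barak, *Computational Complexity: A Modern Approach*, CUP 2009, Def. 17.15–17.16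
  and §17.4.2 (`⊕P`, `⊕·⊕P ⊆ ⊕P`) [AroraBarak2009].
-/

noncomputable section

namespace Literature.Computability.MetaComplexity

open _root_.Computability Complexity Filter Brick Plumb Polynomial

namespace ParityRefuter

/-! ### The self-reducible witness-parity language -/

/-- `witMap ⟨⟨x, ρ⟩, y'⟩ = ⟨x, ρ y'⟩`: re-pairing a prefix-extended witness. [folklore] -/
def witMap : List Bool → List Bool :=
  fanoutFn (fstF ∘ fstF) (OracleCompose.concatFn ∘ fanoutFn (sndF ∘ fstF) sndF)

/-- Value of `witMap`. [folklore] -/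
@[simp] theorem witMap_apply (x ρ y : List Bool) :
    witMap (boolPair (boolPair x ρ) y) = boolPair x (ρ ++ y) := by
  simp [witMap]

/-- `witMap ∈ FP`. [cite: AroraBarak2009, §1.3] -/
theorem witMap_mem_FP : witMap ∈ FP :=
  fanoutFn_mem_FP (comp_mem_FP fstF_mem_FP fstF_mem_FP)
    (comp_mem_FP OracleCompose.concatFn_mem_FP (fanoutFn_mem_FP (comp_mem_FP sndF_mem_FP fstF_mem_FP) sndF_mem_FP))

/-- `gapFn p₁ ⟨x, ρ⟩ = 1^{p₁(|x|) - |ρ|}`: the number of witness bits still to be fixed. [folklore] -/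
def gapFn (p₁ : Polynomial ℕ) : List Bool → List Bool := dropFn ∘ fanoutFn sndF (polyFn p₁ ∘ fstF)

/-- Value of `gapFn`. [folklore] -/
@[simp] theorem gapFn_apply (p₁ : Polynomial ℕ) (x ρ : List Bool) :
    gapFn p₁ (boolPair x ρ) = ones (p₁.eval x.length - ρ.length) := by
  simp [gapFn]

/-- `gapFn p₁ ∈ FP`. [cite: AroraBarak2009, §1.3] -/
theorem gapFn_mem_FP (p₁ : Polynomial ℕ) : gapFn p₁ ∈ FP :=
  comp_mem_FP dropFn_mem_FP (fanoutFn_mem_FP sndF_mem_FP (comp_mem_FP (polyFn_mem_FP p₁) fstF_mem_FP))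

/-- **The self-reducible witness-parity language** of a witness relation `W` with witness length
`p₁`: `⟨x, ρ⟩ ∈ Mlang W p₁` iff `#{y' ∈ {0,1}^{p₁(|x|) - |ρ|} | ⟨x, ρ y'⟩ ∈ W}` is odd — the parity of
the number of accepting witnesses extending the prefix `ρ` (the role played by `⊕SAT` restricted by
a partial assignment in the printed proof). [cite: ChenEtAl2022, §5.3] -/
def Mlang (W : Language Bool) (p₁ : Polynomial ℕ) : Language Bool :=
  {v | Odd (countWitnesses (witMap ⁻¹' W) (gapFn p₁ v).length v)}

/-- **`Mlang W p₁ ∈ ⊕P`** for `W ∈ P` (`⊕·⊕P ⊆ ⊕P`, `paritySum_mem_ParityP`, applied to the `P`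
relation `witMap⁻¹(W)`). [cite: AroraBarak2009, §17.4.2] -/
theorem Mlang_mem_ParityP {W : Language Bool} (hW : W ∈ Classes.P) (p₁ : Polynomial ℕ) :
    Mlang W p₁ ∈ ParityP :=
  ParityClosure.paritySum_mem_ParityP (ParityClosure.P_subset_ParityP (preimage_mem_P hW witMap_mem_FP))
    (gapFn_mem_FP p₁)

/-- The extension count `#{y' ∈ {0,1}^{p₁(|x|) - |ρ|} | ⟨x, ρ y'⟩ ∈ W}`. [cite: ChenEtAl2022, §5.3] -/
def mcount (W : Language Bool) (p₁ : Polynomial ℕ) (x ρ : List Bool) : ℕ :=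
  cnt (p₁.eval x.length - ρ.length) {y | boolPair x (ρ ++ y) ∈ W}

/-- Membership in `Mlang` is oddness of the extension count. [cite: ChenEtAl2022, §5.3] -/
theorem mem_Mlang_iff (W : Language Bool) (p₁ : Polynomial ℕ) (x ρ : List Bool) :
    boolPair x ρ ∈ Mlang W p₁ ↔ Odd (mcount W p₁ x ρ) := by
  change Odd (countWitnesses (witMap ⁻¹' W) (gapFn p₁ (boolPair x ρ)).length (boolPair x ρ)) ↔ _
  rw [PPSharpP.countWitnesses_eq_cnt, gapFn_apply, length_ones', mcount]
  simp only [memL_preimage, witMap_apply]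

/-- **Splitting on the next witness bit**: below the witness length the count is the sum of the
counts of the two one-bit extensions. [cite: ChenEtAl2022, §5.3] -/
theorem mcount_step {W : Language Bool} {p₁ : Polynomial ℕ} {x ρ : List Bool}
    (h : ρ.length < p₁.eval x.length) :
    mcount W p₁ x ρ = mcount W p₁ x (ρ ++ [false]) + mcount W p₁ x (ρ ++ [true]) := by
  unfold mcount
  simp only [List.length_append, List.length_singleton, List.append_assoc, List.singleton_append]
  rw [show p₁.eval x.length - ρ.length = p₁.eval x.length - (ρ.length + 1) + 1 by omega, cnt_succ]
  rfl

open Classical in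
/-- **At the witness length the count is the indicator of `W`.** [cite: ChenEtAl2022, §5.3] -/
theorem mcount_leaf {W : Language Bool} {p₁ : Polynomial ℕ} {x ρ : List Bool}
    (h : p₁.eval x.length ≤ ρ.length) :
    mcount W p₁ x ρ = if boolPair x ρ ∈ W then 1 else 0 := by
  unfold mcount
  rw [show p₁.eval x.length - ρ.length = 0 by omega, cnt_zero]
  simp

/-- **Self-reducibility**: `M(x, ρ) = M(x, ρ0) ⊕ M(x, ρ1)` below the witness length.
[cite: ChenEtAl2022, §5.3] -/
theorem mem_Mlang_step {W : Language Bool} {p₁ : Polynomial ℕ} {x ρ : List Bool}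
    (h : ρ.length < p₁.eval x.length) :
    boolPair x ρ ∈ Mlang W p₁ ↔ (boolPair x (ρ ++ [false]) ∈ Mlang W p₁ ↔ boolPair x (ρ ++ [true]) ∉ Mlang W p₁) := by
  rw [mem_Mlang_iff, mem_Mlang_iff, mem_Mlang_iff, mcount_step h, Nat.odd_add, ← Nat.not_odd_iff_even]

/-- **Leaves**: `M(x, ρ) = W(x, ρ)` at (and beyond) the witness length. [cite: ChenEtAl2022, §5.3] -/
theorem mem_Mlang_leaf {W : Language Bool} {p₁ : Polynomial ℕ} {x ρ : List Bool}
    (h : p₁.eval x.length ≤ ρ.length) :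
    boolPair x ρ ∈ Mlang W p₁ ↔ boolPair x ρ ∈ W := by
  classical
  rw [mem_Mlang_iff, mcount_leaf h]
  split_ifs with hW <;> simp [hW]

/-- **The root**: `⟨x, ε⟩ ∈ M` iff the number of `W`-witnesses of `x` of length `p₁(|x|)` is odd
(membership of `x` in the `⊕P` language defined by `W, p₁`). [cite: AroraBarak2009, Def. 17.15] -/
theorem mem_Mlang_nil_iff (W : Language Bool) (p₁ : Polynomial ℕ) (x : List Bool) :
    boolPair x [] ∈ Mlang W p₁ ↔ Odd (countWitnesses W (p₁.eval x.length) x) := by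
  rw [mem_Mlang_iff, PPSharpP.countWitnesses_eq_cnt]
  simp [mcount]

/-! ### Levels: coding instances by words of one length -/

/-- `unpad t`: strip the `10*`-padding at the high end (drop the redundant zeros, then the last
`1`). [folklore] -/
def unpad (t : List Bool) : List Bool := (norm t).take ((norm t).length - 1)

/-- `norm (y 1 0ᵏ) = y 1`. [folklore] -/
theorem norm_append_true_zeros (y : List Bool) (k : ℕ) : norm (y ++ true :: zeros k) = y ++ [true] := by
  induction y with
  | nil =>
    have h0 : norm (zeros k) = [] := (norm_eq_nil_iff _).2 (bitsToNat_zeros k)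
    rw [List.nil_append, norm_cons, if_pos h0]
    rfl
  | cons b y ih =>
    rw [List.cons_append, norm_cons, ih, if_neg (by simp)]
    rfl

/-- **`unpad (y 1 0ᵏ) = y`.** [folklore] -/
@[simp] theorem unpad_pad (y : List Bool) (k : ℕ) : unpad (y ++ true :: zeros k) = y := by
  rw [unpad, norm_append_true_zeros]
  simp

/-- `|unpad t| ≤ |t| - 1`. [folklore] -/
theorem length_unpad_le (t : List Bool) : (unpad t).length ≤ t.length - 1 := by
  have h := length_norm_le t
  simp only [unpad, List.length_take]
  omega

/-- The word length of level `n`: `S(n) = (n + 1) + (p₁(n) + 1)`. [cite: ChenEtAl2022, §5.3] -/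
def Slen (p₁ : Polynomial ℕ) : Polynomial ℕ := X + 1 + (p₁ + 1)

/-- `S(n) = (n + 1) + (p₁(n) + 1)`. [folklore] -/
@[simp] theorem Slen_eval (p₁ : Polynomial ℕ) (n : ℕ) : (Slen p₁).eval n = n + 1 + (p₁.eval n + 1) := by
  simp [Slen]

/-- **Decoding a word of level `n`**: the instance `⟨x, ρ⟩` with `x = unpad (t ↾ (n+1))`,
`ρ = unpad (t ⇂ (n+1))`. Total; `|x| ≤ n` always. [cite: ChenEtAl2022, §5.3] -/
def inst (n : ℕ) (t : List Bool) : List Bool × List Bool := (unpad (t.take (n + 1)), unpad (t.drop (n + 1)))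

/-- `|x| ≤ n` for the decoded instance. [folklore] -/
theorem length_inst_fst_le (n : ℕ) (t : List Bool) : (inst n t).1.length ≤ n := by
  have h := length_unpad_le (t.take (n + 1))
  simp only [inst, List.length_take] at h ⊢
  omega

/-- `|ρ| ≤ |t| - (n + 2)` for the decoded instance; in particular `|ρ| ≤ p₁(n)` on words of
level `n`. [folklore] -/
theorem length_inst_snd_le (n : ℕ) (t : List Bool) : (inst n t).2.length ≤ t.length - (n + 1) - 1 := by
  have h := length_unpad_le (t.drop (n + 1))
  simp only [inst, List.length_drop] at h ⊢
  omega

/-- **Coding an instance** `⟨x, ρ⟩`, `|x| ≤ n`, `|ρ| ≤ p₁(n)`, by a word of level `n`. [cite: ChenEtAl2022, §5.3] -/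
def code (p₁ : Polynomial ℕ) (n : ℕ) (x ρ : List Bool) : List Bool :=
  (x ++ true :: zeros (n - x.length)) ++ (ρ ++ true :: zeros (p₁.eval n - ρ.length))

/-- A code word has length `S(n)`. [folklore] -/
theorem length_code {p₁ : Polynomial ℕ} {n : ℕ} {x ρ : List Bool} (hx : x.length ≤ n) (hρ : ρ.length ≤ p₁.eval n) :
    (code p₁ n x ρ).length = (Slen p₁).eval n := by
  simp only [code, List.length_append, List.length_cons, length_zeros, Slen_eval]
  omega

/-- **Decoding a code word returns the instance.** [folklore] -/
theorem inst_code {p₁ : Polynomial ℕ} {n : ℕ} {x ρ : List Bool} (hx : x.length ≤ n) :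
    inst n (code p₁ n x ρ) = (x, ρ) := by
  have hl : (x ++ true :: zeros (n - x.length)).length = n + 1 := by
    simp only [List.length_append, List.length_cons, length_zeros]; omega
  simp only [inst, code]
  rw [List.take_left' hl, List.drop_left' hl, unpad_pad, unpad_pad]

/-! ### The data of the proof -/

/-- **The data of the `⊕P` refuter construction and their defining properties.** `L`: the
`⊕P`-hard paddable language; `A`: the refuted language (a `BPP` language in the application; here
arbitrary); `W ∈ P`, `p₁`: witness relation and witness length of a `⊕P` language `L₁` (outside
`BPP` in the application); `red`: a Karp reduction of `Mlang W p₁` to `L`; `pad`: the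
length-padding of `L` (`IsLengthPaddable`); `Λ₁`: a strictly increasing polynomial dominating the
lengths of the reduced instances of each level, with room (`Λ₁ n ≥ n + S n + 7`) for the error
bounds of the probabilistic part; `LA ∈ P`, `q`: an amplified `BPP` witness of `A` erring on at
most a `2^{-|w|}` fraction of the seeds of length `q(|w|)`, on every string `w` (Arora–Barak,
Thm. 7.10; in the application from `A ∈ BPP` by `BPP_subset_bpErr_two_pow`).
[cite: ChenEtAl2022, §5.3] -/
structure Ctx where
  /-- the hard language -/
  L : Language Bool
  /-- the refuted language -/
  A : Language Bool
  /-- witness relation of `L₁` -/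
  W : Language Bool
  /-- witness length of `L₁` -/
  p₁ : Polynomial ℕ
  /-- Karp reduction of `Mlang W p₁` to `L` -/
  red : List Bool → List Bool
  /-- length padding of `L` -/
  pad : List Bool × ℕ → List Bool
  /-- padded length of level `n` -/
  Λ₁ : Polynomial ℕ
  /-- amplified `BPP` witness of `A` (error `≤ 2^{-|w|}`) -/
  LA : Language Bool
  /-- its seed length -/
  q : Polynomial ℕ
  /-- `W ∈ P` -/
  W_mem : W ∈ Classes.P
  /-- `red ∈ FP` -/
  red_mem : red ∈ FP
  /-- `red` reduces `Mlang W p₁` to `L` -/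
  red_spec : ∀ v : List Bool, v ∈ Mlang W p₁ ↔ red v ∈ L
  /-- the padding is polynomial time from `⟨x, 1ᵐ⟩` -/
  pad_poly : PolyTimeComputable (fun p : List Bool × ℕ => boolPair p.1 (unaryEncodeNat p.2))
    (id : List Bool → List Bool) pad
  /-- the padding yields length exactly `m` and preserves membership in `L` -/
  pad_spec : ∀ (x : List Bool) (m : ℕ), x.length ≤ m → (pad (x, m)).length = m ∧ (pad (x, m) ∈ L ↔ x ∈ L)
  /-- `Λ₁` dominates the reduced instances of each level -/
  red_le : ∀ (n : ℕ) (v : List Bool), v.length ≤ 3 * (Slen p₁).eval n → (red v).length ≤ Λ₁.eval n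
  /-- room in `Λ₁` -/
  Λ₁_ge : ∀ n : ℕ, n + (Slen p₁).eval n + 7 ≤ Λ₁.eval n
  /-- `Λ₁` increases at each step -/
  Λ₁_lt : ∀ n : ℕ, Λ₁.eval n < Λ₁.eval (n + 1)
  /-- `LA ∈ P` -/
  LA_mem : LA ∈ Classes.P
  /-- `LA` errs about `A` on at most a `2^{-|w|}` fraction of the seeds, on every `w` -/
  LA_err : ∀ w : List Bool,
    uniformProb (q.eval w.length) {y : List Bool | ¬ (boolPair w y ∈ LA ↔ w ∈ A)} ≤ 1 / 2 ^ w.length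

namespace Ctx

variable (c : Ctx)

/-- The word length `S(n)` of level `n`. [cite: ChenEtAl2022, §5.3] -/
def S (n : ℕ) : ℕ := (Slen c.p₁).eval n

/-- `S(n) = (n + 1) + (p₁(n) + 1)`. [folklore] -/
theorem S_eq (n : ℕ) : c.S n = n + 1 + (c.p₁.eval n + 1) := Slen_eval c.p₁ n

/-- **The padded reduction of level `n`**: `Rn n v = pad (red v, Λ₁ n)`. [cite: ChenEtAl2022, §5.3 ("by padding, we assume the input strings received by `A` have length exactly `ℓ(n)`")] -/
def Rn (n : ℕ) (v : List Bool) : List Bool := c.pad (c.red v, c.Λ₁.eval n)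

/-- **`Rn` produces `L`-instances of length exactly `Λ₁(n)` with the `M`-value of the instance**,
for instances of size `≤ 3 S(n)`. [cite: ChenEtAl2022, §5.3] -/
theorem Rn_spec {n : ℕ} {v : List Bool} (hv : v.length ≤ 3 * c.S n) :
    (c.Rn n v).length = c.Λ₁.eval n ∧ (c.Rn n v ∈ c.L ↔ v ∈ Mlang c.W c.p₁) := by
  have h := c.pad_spec (c.red v) (c.Λ₁.eval n) (c.red_le n v hv)
  exact ⟨h.1, h.2.trans (c.red_spec v).symm⟩

end Ctx

/-- The suffixes `ε, 0, 1` of the instance and its two children. [folklore] -/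
def sfx : Fin 3 → List Bool := ![[], [false], [true]]

/-- `sfx 0 = ε`. [folklore] -/
@[simp] theorem sfx_zero : sfx 0 = [] := rfl
/-- `sfx 1 = 0`. [folklore] -/
@[simp] theorem sfx_one : sfx 1 = [false] := rfl
/-- `sfx 2 = 1`. [folklore] -/
@[simp] theorem sfx_two : sfx 2 = [true] := rfl

/-- `|sfx i| ≤ 1`. [folklore] -/
theorem length_sfx_le (i : Fin 3) : (sfx i).length ≤ 1 := by
  fin_cases i <;> simp

/-- **The instance coded by `t` at level `n` and its two children**: `child n t i = ⟨x, ρ · sfx i⟩`.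
[cite: ChenEtAl2022, §5.3] -/
def child (n : ℕ) (t : List Bool) (i : Fin 3) : List Bool := boolPair (inst n t).1 ((inst n t).2 ++ sfx i)

/-- Size of the instance and its children on words of level `n`: `≤ 3 S(n)`. [folklore] -/
theorem length_child_le {p₁ : Polynomial ℕ} {n : ℕ} {t : List Bool} (ht : t.length ≤ (Slen p₁).eval n) (i : Fin 3) :
    (child n t i).length ≤ 3 * (Slen p₁).eval n := by
  have h1 := length_inst_fst_le n t
  have h2 := length_inst_snd_le n t
  have h3 := length_sfx_le i
  simp only [child, length_boolPair, List.length_append, Slen_eval] at ht ⊢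
  omega

namespace Ctx

variable (c : Ctx)

/-- **The triple of level `n` at `t`**: the padded reductions of the instance and of its two
children, three strings of length `Λ₁(n)`. [cite: ChenEtAl2022, §5.3 ("three strings which contain a counterexample")] -/
def tri (n : ℕ) (t : List Bool) (i : Fin 3) : List Bool := c.Rn n (child n t i)

/-- **Local inconsistency of `A` at the word `t` of level `n`.** Below the witness length:
`A(T₀) ≠ A(T₁) ⊕ A(T₂)` for the triple `T = tri n t`; at or beyond it: `A(T₀) ≠ W(x, ρ)` (the leaf
value, computable directly). [cite: ChenEtAl2022, §5.3 ("`A(R(φ)) ≠ A(R(φ₀)) ⊕ A(R(φ₁))`")] -/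
def Cloc (n : ℕ) (t : List Bool) : Prop :=
  if c.p₁.eval (inst n t).1.length ≤ (inst n t).2.length then ¬ (c.tri n t 0 ∈ c.A ↔ child n t 0 ∈ c.W)
  else ¬ (c.tri n t 0 ∈ c.A ↔ (c.tri n t 1 ∈ c.A ↔ c.tri n t 2 ∉ c.A))

/-- **Good levels**: some word of level `n` is locally inconsistent. [cite: ChenEtAl2022, §5.3] -/
def GoodLevel (n : ℕ) : Prop := ∃ t : List Bool, t.length = c.S n ∧ c.Cloc n t

/-- The strings of the triple have length `Λ₁(n)` (on words of length `≤ S(n)`). [folklore] -/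
theorem length_tri {n : ℕ} {t : List Bool} (ht : t.length ≤ c.S n) (i : Fin 3) :
    (c.tri n t i).length = c.Λ₁.eval n :=
  (c.Rn_spec (length_child_le ht i)).1

/-- The `L`-value of a triple string is the `M`-value of the instance/child. [cite: ChenEtAl2022, §5.3] -/
theorem tri_mem_iff {n : ℕ} {t : List Bool} (ht : t.length ≤ c.S n) (i : Fin 3) :
    c.tri n t i ∈ c.L ↔ child n t i ∈ Mlang c.W c.p₁ :=
  (c.Rn_spec (length_child_le ht i)).2

/-- **The `L`-values of a triple are consistent** (because `red` reduces the self-reducible `M`).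
[cite: ChenEtAl2022, §5.3] -/
theorem L_consistent {n : ℕ} {t : List Bool} (ht : t.length ≤ c.S n) :
    if c.p₁.eval (inst n t).1.length ≤ (inst n t).2.length then (c.tri n t 0 ∈ c.L ↔ child n t 0 ∈ c.W)
    else (c.tri n t 0 ∈ c.L ↔ (c.tri n t 1 ∈ c.L ↔ c.tri n t 2 ∉ c.L)) := by
  split_ifs with h
  · rw [c.tri_mem_iff ht 0]
    simpa [child] using mem_Mlang_leaf (W := c.W) h
  · rw [c.tri_mem_iff ht 0, c.tri_mem_iff ht 1, c.tri_mem_iff ht 2]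
    simpa [child] using mem_Mlang_step (W := c.W) (not_le.1 h)

/-- **At a locally inconsistent word one string of the triple lies in `L ∆ A`** — the
"three strings which contain a counterexample" of the printed proof (at a leaf, the first one).
[cite: ChenEtAl2022, §5.3] -/
theorem exists_tri_mem_symmDiff {n : ℕ} {t : List Bool} (ht : t.length ≤ c.S n) (hC : c.Cloc n t) :
    ∃ i : Fin 3, (c.tri n t i ∈ c.L ↔ c.tri n t i ∉ c.A) := by
  have hL := c.L_consistent ht
  unfold Cloc at hC
  split_ifs at hL hC with h
  · exact ⟨0, by tauto⟩
  · by_contra hne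
    simp only [not_exists] at hne
    have h0 := hne 0
    have h1 := hne 1
    have h2 := hne 2
    tauto

/-- **Quiet levels compute `M`.** If no word of level `n` is locally inconsistent then
`A (Rn n ⟨x, ρ⟩) = M(x, ρ)` for all `|x| ≤ n`, `|ρ| ≤ p₁(|x|)` (downward induction on the gap
`p₁(|x|) - |ρ|` along the self-reduction, through the code words of the instances).
[cite: ChenEtAl2022, §5.3 ("otherwise it would contradict the assumption that `⊕P ⊄ 𝒞`")] -/
theorem A_agrees_of_quiet {n : ℕ} (hq : ∀ t : List Bool, t.length = c.S n → ¬ c.Cloc n t) :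
    ∀ (d : ℕ) (x ρ : List Bool), x.length ≤ n → ρ.length + d = c.p₁.eval x.length →
      (c.Rn n (boolPair x ρ) ∈ c.A ↔ boolPair x ρ ∈ Mlang c.W c.p₁) := by
  intro d
  induction d with
  | zero =>
    intro x ρ hx hd
    have hρn : ρ.length ≤ c.p₁.eval n := by
      have := TM2Iter.eval_mono c.p₁ hx; omega
    have ht : (code c.p₁ n x ρ).length = c.S n := length_code hx hρn
    have hC := hq _ ht
    simp only [Cloc, inst_code hx, tri, child] at hC
    rw [if_pos (by omega)] at hC
    simp only [sfx_zero, List.append_nil, not_not] at hC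
    rw [hC, mem_Mlang_leaf (by omega)]
  | succ d ih =>
    intro x ρ hx hd
    have hρn : ρ.length ≤ c.p₁.eval n := by
      have := TM2Iter.eval_mono c.p₁ hx; omega
    have ht : (code c.p₁ n x ρ).length = c.S n := length_code hx hρn
    have hC := hq _ ht
    simp only [Cloc, inst_code hx, tri, child] at hC
    rw [if_neg (by omega)] at hC
    simp only [sfx_zero, sfx_one, sfx_two, List.append_nil, not_not] at hC
    have h0 := ih x (ρ ++ [false]) hx (by simp only [List.length_append, List.length_singleton]; omega)
    have h1 := ih x (ρ ++ [true]) hx (by simp only [List.length_append, List.length_singleton]; omega)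
    rw [hC, h0, h1]
    exact (mem_Mlang_step (W := c.W) (p₁ := c.p₁) (x := x) (ρ := ρ) (by omega)).symm

/-! ### Good levels are frequent -/

/-- `padStr ⟨u, v⟩ = pad (u, |v|)`: the padding as a string function. [folklore] -/
def padStr : List Bool → List Bool := fun w => c.pad (fstF w, (sndF w).length)

/-- Value of `padStr` on a pair. [folklore] -/
@[simp] theorem padStr_boolPair (u v : List Bool) : c.padStr (boolPair u v) = c.pad (u, v.length) := by
  simp [padStr]

/-- **The padding is a polynomial-time string function** (its machine composed with the
normaliser `w ↦ ⟨fstF w, 1^{|sndF w|}⟩ ∈ FP`, which presents every string in the input format of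
the padding machine). [cite: AroraBarak2009, §1.3] -/
theorem padStr_mem_FP : c.padStr ∈ FP := by
  have hn : fanoutFn fstF (onesFn ∘ sndF) ∈ FP :=
    fanoutFn_mem_FP fstF_mem_FP (comp_mem_FP onesFn_mem_FP sndF_mem_FP)
  have hn' : PolyTimeComputable (id : List Bool → List Bool)
      (fun p : List Bool × ℕ => boolPair p.1 (unaryEncodeNat p.2))
      (fun w : List Bool => (fstF w, (sndF w).length)) := by
    obtain ⟨p, M, hM⟩ := hn
    refine ⟨p, M, fun w => ?_⟩
    have h := hM w
    simp only [id, fanoutFn_apply, Function.comp_apply, onesFn] at h ⊢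
    exact h
  exact PolyTimeComputable.comp_holds c.pad_poly hn'

/-- **Quiet late levels put `L₁` in `BPP`.** If all but finitely many levels are quiet and
`A ∈ BPP`, then the `⊕P` language `L₁` of `W, p₁` is the `FP`-preimage of `A` under
`x ↦ Rn (|x| + n₀) ⟨x, ε⟩`, hence in `BPP`. [cite: ChenEtAl2022, §5.3] -/
theorem mem_BPP_of_eventually_quiet {L₁ : Language Bool}
    (hL₁ : ∀ x : List Bool, x ∈ L₁ ↔ boolPair x [] ∈ Mlang c.W c.p₁) (hA : c.A ∈ BPP)
    (hq : ∀ᶠ n in atTop, ¬ c.GoodLevel n) : L₁ ∈ BPP := by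
  obtain ⟨n₀, hn₀⟩ := eventually_atTop.1 hq
  -- the reduction `F x = Rn (|x| + n₀) ⟨x, ε⟩`
  set F : List Bool → List Bool :=
    c.padStr ∘ fanoutFn (c.red ∘ fanoutFn id (fun _ => [])) (polyFn (c.Λ₁.comp (X + C n₀))) with hF
  have hFP : F ∈ FP :=
    comp_mem_FP c.padStr_mem_FP (fanoutFn_mem_FP
      (comp_mem_FP c.red_mem (fanoutFn_mem_FP OracleCompose.id_mem_FP (const_mem_FP [])))
      (polyFn_mem_FP _))
  have hFx : ∀ x : List Bool, F x = c.Rn (x.length + n₀) (boolPair x []) := by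
    intro x
    simp [hF, Rn, eval_comp]
  have hpre : L₁ = F ⁻¹' c.A := by
    ext x
    rw [memL_preimage, hFx, hL₁]
    have hquiet : ∀ t : List Bool, t.length = c.S (x.length + n₀) → ¬ c.Cloc (x.length + n₀) t := by
      intro t ht hC
      exact hn₀ (x.length + n₀) (by omega) ⟨t, ht, hC⟩
    exact (c.A_agrees_of_quiet hquiet (c.p₁.eval x.length) x [] (by omega) (by simp)).symm
  rw [hpre]
  exact preimage_mem_BPP hA hFP

/-- **Good levels are frequent**: if `A ∈ BPP` and the `⊕P` language `L₁` of `W, p₁` is not in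
`BPP`, then infinitely many levels carry a locally inconsistent word. [cite: ChenEtAl2022, §5.3] -/
theorem frequently_goodLevel {L₁ : Language Bool}
    (hL₁ : ∀ x : List Bool, x ∈ L₁ ↔ boolPair x [] ∈ Mlang c.W c.p₁) (hA : c.A ∈ BPP) (hL₁' : L₁ ∉ BPP) :
    ∃ᶠ n in atTop, c.GoodLevel n := by
  by_contra h
  rw [Filter.not_frequently] at h
  exact hL₁' (c.mem_BPP_of_eventually_quiet hL₁ hA h)

end Ctx

end ParityRefuter

end Literature.Computability.MetaComplexity
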